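import Summits.QuantumFields.BalabanUV.Beta.GAN24.LatticeKernelConvolutionTwo
import Summits.QuantumFields.BalabanUV.Beta.GAN24.AliasTiling

/-!
# `BalabanUV.Beta.GAN24.LatticeKernelDiagonal` — binder row G-an2-4 / (CONV-C), STENCIL slot, campaign «E3Shape» (`SKELETON-S3.md` node S3-L1,
# ANALYSIS HALF, part 3): GLOBAL `2π`-PERIODICITY of a symbol, TRANSLATION INVARIANCE of the zone integral of a periodic function, and
# THE DIAGONAL LEMMA `K₂[(p,q) ↦ H(p+q)](a, b) = [a = b] · K[H](a)` — the two-momentum form of momentum conservation at a vertex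
# (a weighted sum of translated stencils `Σ'_u h(u) • T(· − u, · − u)`, an2's `vertexOf` pattern, has bi-symbol `ĥ(p+q) · T̂(p,q)`)

NOT IN PRINT; OUR BOOKKEEPING (engine «LK-CONV*» part 3, CLAIMS l.4153 ∕ l.4206 ∕ l.4361; row owner gan24-p1-g3 RULINGS-2 l.4221 «part 2 (mixed∕diagonal forms
on leaf-14's `latticeKernel₂`) … one writer = you»; unit b2b-balaban-gan24-formalise-leaf-07, gen 9).  HONEST FRAMING (cell contract, verbatim):
«discharging `BetaPertH` makes Bałaban's UV stability UNCONDITIONAL — a real constructive-QFT result; it is NOT the continuum limit and NOT the Clay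
problem.»  HONEST DEPENDENCY (verbatim): «continuum YM on T⁴ ⇐ BetaPertH ∧ nine spine estimates (0/9 proved); BetaPertH ⇐ (D1) ∧ (D4) ∧ CAP+tail;
G-an2-4 gates asym, D1 and NE2/3/4.»  [folklore] Fourier analysis on `ℤ^{d+1}`: cites nothing, mints no `def … : Prop`, asserts no statement of
Bałaban's, instantiates no wall binder.  NOT summit progress.

## Why (context only; asserted nowhere below)

pv17's `StripRegular H κ M` speaks of `H` on ONE period box `|Re p_μ| ≤ π` (+ the strip); a two-momentum symbol `(p, q) ↦ H(p + q)` reads `H` on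
`|Re| ≤ 2π`, so the diagonal lemma needs `H` to be GLOBALLY `2π`-periodic in each coordinate (as every actual symbol of the cell is: trigonometric
polynomials `FibreInverseDecay.cphase_periodic` and their inverses).  With periodicity, (i) `H` on the reals is the continuous torus function
`B4TorusKernel.descend H` read back (`descend_coe_of_periodic`), hence bounded by `M` and continuous EVERYWHERE on `ℝ^{d+1}`; (ii) the zone integral of a
periodic function is translation invariant (`setIntegral_BZ_comp_add_of_periodic`, via leaf-17's `AliasTiling` period-box calculus,
itself built on Mathlib's `UnitAddTorus.integral_preimage`); (iii) `(p,q) ↦ H(p+q)` is jointly strip regular OF HALF-WIDTH ZERO (`stripRegular_joint_shear`), so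
leaf-14's Fubini `latticeKernel₂_eq_iterated` applies, the inner zone integral is `e^{−ip·b} K[H](b)` by (ii), and the outer one is a pure phase,
`B4Green244.latticeKernel_phase_mul` + `FibreInverseDecay.latticeKernel_const`.

## Contents (all [folklore]; `hper : ∀ i p, H (Function.update p i (p i + 2π)) = H p`)
§1 `periodic_update_int`, `periodic_add_intVec` (integer-vector periodicity of a symbol on COMPLEX momenta), **`descend_coe_of_periodic`**, `norm_le_of_periodic`,
   `continuous_ofRealVec_of_periodic`.
§2 `setIntegral_pbox_comp_add` (translation of a period-box integral), **`setIntegral_BZ_comp_add_of_periodic : ∫_{q ∈ BZ} F(p + q) dq = ∫_{q ∈ BZ} F(q) dq`**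
   (on leaf-17's `GAN24/AliasTiling` period boxes — `pbox_neg_pi_ae_eq_BZ`, `setIntegral_pbox_eq_BZ`, `rep_coe_eq_add_int` BY NAME; their §2 was in turn re-proved from the
   records version of this file — one writer per statement now).
§3 **`stripRegular_joint_shear : StripRegular (joint fun p q => H (p + q)) 0 M`**; `latticeKernel_shear_inner` (the inner kernel at real `p` is
   `e^{−ip·b} K[H](b)`); **`latticeKernel₂_shear : latticeKernel₂ (fun p q => H (p + q)) a b = if a = b then latticeKernel H a else 0`**.
WHAT IS NOT HERE: the block swap ∕ right-hand mixed form; phases on leaf-14's `latticeKernel₂` (their `StripRegularBiLocAlgebra.latticeKernel₂_phase_left∕right`);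
any symbol of an2's objects.  NOT BetaPertH, NOT continuum, NOT Clay.
-/

noncomputable section

open Complex Set MeasureTheory Filter Topology
open Literature.MathematicalPhysics.QuantumFieldTheory.Balaban1983to89
open B4Strip (ofRealVec Strip reVec)
open B4ContourShift (BZ latticeKernel StripRegular supNorm latticeKernel_decay ofRealVec_mem_Strip openRect integrand phase)
open B4Green244 (phaseC latticeKernel_phase_mul latticeKernel_congr)
open B4TorusKernel (rep rep_mem descend descendC descendC_apply continuous_descend unitBox two_pi_mul_mem_BZ)
open B5Strip145Analytic (strip_mono)
open Beta.FibreInverseDecay (reVec_mem_BZ latticeKernel_const)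
open Summit.QuantumFields.BalabanUV.Beta.GAN24.LatticeKernelConvolution (norm_descend_le stripRegular_nonneg toT continuous_toT)
open Summit.QuantumFields.BalabanUV.Beta.GAN24.LatticeKernelConvolutionTwo (stripRegular_of_update fstC_update_inl2 sndC_update_inl2 fstC_update_inr2
  sndC_update_inr2 openRect_zero ofRealVec_reVec_of_mem_Strip_zero latticeKernel_const_mul)
open Summit.QuantumFields.BalabanUV.Beta.GAN24.StripRegularRestrict (inl2 inr2 pair pair_inl pair_inr inl2_or_inr2 fstC sndC fstC_apply sndC_apply fstC_pair
  sndC_pair joint joint_apply joint_pair ofRealVec_pair)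
open Summit.QuantumFields.BalabanUV.Beta.GAN24.StripRegularBiLoc (latticeKernel₂ latticeKernel₂_eq_iterated pair_mem_BZ_iff)
open Summit.QuantumFields.BalabanUV.Beta.GAN24.AliasTiling (pbox measurableSet_pbox rep_coe_eq_add_int pbox_neg_pi_ae_eq_BZ setIntegral_pbox_eq_BZ)
open scoped Real Pointwise

namespace Summit.QuantumFields.BalabanUV.Beta.GAN24.LatticeKernelDiagonal

variable {d : ℕ}

/-! ## §1 Global `2π`-periodicity -/

section Periodic

variable {H : (Fin (d + 1) → ℂ) → ℂ}

/-- [folklore] integer iterates of the coordinate period. -/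
theorem periodic_update_int (hper : ∀ (i : Fin (d + 1)) (p : Fin (d + 1) → ℂ), H (Function.update p i (p i + 2 * π)) = H p)
    (i : Fin (d + 1)) (p : Fin (d + 1) → ℂ) (k : ℤ) : H (Function.update p i (p i + 2 * π * k)) = H p := by
  induction k using Int.induction_on generalizing p with
  | zero => simp
  | succ n ih =>
      have e : Function.update p i (p i + 2 * π * ((n : ℤ) + 1 : ℤ)) =
          Function.update (Function.update p i (p i + 2 * π * (n : ℤ))) i ((Function.update p i (p i + 2 * π * (n : ℤ))) i + 2 * π) := by
        funext j
        by_cases hj : j = i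
        · subst hj; simp only [Function.update_self]; push_cast; ring
        · simp only [Function.update_of_ne hj]
      rw [e, hper, ih]
  | pred n ih =>
      have e2 : Function.update p i (p i + 2 * π * (-(n : ℤ) : ℤ)) =
          Function.update (Function.update p i (p i + 2 * π * (-(n : ℤ) - 1 : ℤ))) i
            ((Function.update p i (p i + 2 * π * (-(n : ℤ) - 1 : ℤ))) i + 2 * π) := by
        funext j
        by_cases hj : j = i
        · subst hj; simp only [Function.update_self]; push_cast; ring
        · simp only [Function.update_of_ne hj]
      rw [← ih p, e2, hper]

/-- [folklore] INTEGER-VECTOR PERIODICITY: `H(p + 2π k) = H(p)` for `k ∈ ℤ^{d+1}`. -/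
theorem periodic_add_intVec (hper : ∀ (i : Fin (d + 1)) (p : Fin (d + 1) → ℂ), H (Function.update p i (p i + 2 * π)) = H p)
    (p : Fin (d + 1) → ℂ) (k : Fin (d + 1) → ℤ) : H (p + fun i => (2 * π * (k i : ℝ) : ℂ)) = H p := by
  classical
  -- add the coordinates one at a time
  have key : ∀ s : Finset (Fin (d + 1)), H (p + fun i => if i ∈ s then (2 * π * (k i : ℝ) : ℂ) else 0) = H p := by
    intro s
    induction s using Finset.induction_on with
    | empty =>
        have e0 : (fun i : Fin (d + 1) => if i ∈ (∅ : Finset (Fin (d + 1))) then (2 * π * (k i : ℝ) : ℂ) else 0) = 0 := by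
          funext i; simp
        rw [e0, add_zero]
    | insert j s hj ih =>
        have e : (p + fun i => if i ∈ insert j s then (2 * π * (k i : ℝ) : ℂ) else 0) =
            Function.update (p + fun i => if i ∈ s then (2 * π * (k i : ℝ) : ℂ) else 0) j
              ((p + fun i => if i ∈ s then (2 * π * (k i : ℝ) : ℂ) else 0) j + 2 * π * (k j : ℤ)) := by
          funext i
          by_cases hi : i = j
          · subst hi
            simp only [Function.update_self, Pi.add_apply, Finset.mem_insert, true_or, if_true, hj, if_false]
            push_cast; ring
          · rw [Function.update_of_ne hi]
            simp only [Pi.add_apply, Finset.mem_insert, hi, false_or]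
        rw [e, periodic_update_int hper, ih]
  have := key Finset.univ
  simpa using this

/-- [folklore] **THE DESCENT READ BACK EVERYWHERE**: for a globally periodic `H`, `descend H (↑s) = H(2π s)` for EVERY real vector `s` (not only on the unit box). -/
theorem descend_coe_of_periodic (hper : ∀ (i : Fin (d + 1)) (p : Fin (d + 1) → ℂ), H (Function.update p i (p i + 2 * π)) = H p)
    (s : Fin (d + 1) → ℝ) : descend H (fun i => ((s i : ℝ) : UnitAddCircle)) = H (ofRealVec fun i => 2 * π * s i) := by
  choose k hk using fun i => rep_coe_eq_add_int (s i)
  unfold descend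
  have e : ofRealVec (fun i => 2 * π * rep ((s i : ℝ) : UnitAddCircle)) = ofRealVec (fun i => 2 * π * s i) + fun i => (2 * π * (k i : ℝ) : ℂ) := by
    funext i
    simp only [ofRealVec, Pi.add_apply, hk i]
    push_cast; ring
  rw [e, periodic_add_intVec hper]

/-- [folklore] hence a periodic strip-regular symbol is bounded by `M` at EVERY real momentum. -/
theorem norm_le_of_periodic {κ M : ℝ} (h : StripRegular H κ M) (hκ : 0 ≤ κ)
    (hper : ∀ (i : Fin (d + 1)) (p : Fin (d + 1) → ℂ), H (Function.update p i (p i + 2 * π)) = H p) (s : Fin (d + 1) → ℝ) :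
    ‖H (ofRealVec s)‖ ≤ M := by
  have e : ofRealVec s = ofRealVec (fun i => 2 * π * ((2 * π)⁻¹ * s i)) := by
    funext i; simp only [ofRealVec]; field_simp
  rw [e, ← descend_coe_of_periodic hper]
  exact norm_descend_le h hκ _

/-- [folklore] … and continuous at EVERY real momentum (the torus function `descend H` is continuous, `B4TorusKernel.continuous_descend`). -/
theorem continuous_ofRealVec_of_periodic {κ M : ℝ} (h : StripRegular H κ M) (hκ : 0 ≤ κ)
    (hper : ∀ (i : Fin (d + 1)) (p : Fin (d + 1) → ℂ), H (Function.update p i (p i + 2 * π)) = H p) :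
    Continuous fun s : Fin (d + 1) → ℝ => H (ofRealVec s) := by
  have e : (fun s : Fin (d + 1) → ℝ => H (ofRealVec s)) = fun s => descend H (fun i => (((2 * π)⁻¹ * s i : ℝ) : UnitAddCircle)) := by
    funext s
    rw [descend_coe_of_periodic hper]
    congr 1; funext i; simp only [ofRealVec]; field_simp
  rw [e]
  refine (continuous_descend h hκ).comp (continuous_pi fun i => ?_)
  exact (AddCircle.continuous_mk' (1 : ℝ)).comp ((continuous_const.mul (continuous_apply i)))

end Periodic

/-! ## §2 Translation invariance of the zone integral of a periodic function (on leaf-17's `AliasTiling` period boxes) -/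

section Translation

/-- [folklore] TRANSLATION of a period-box integral (Lebesgue measure on `ℝ^{d+1}` is translation invariant): `∫_{pbox a} g(x + c) dx = ∫_{pbox (a+c)} g`. -/
theorem setIntegral_pbox_comp_add (g : (Fin (d + 1) → ℝ) → ℂ) (a c : Fin (d + 1) → ℝ) :
    ∫ x in pbox a, g (x + c) = ∫ y in pbox (a + c), g y := by
  have hmp := measurePreserving_add_right (volume : Measure (Fin (d + 1) → ℝ)) c
  have hemb : MeasurableEmbedding (fun x : Fin (d + 1) → ℝ => x + c) := (MeasurableEquiv.addRight c).measurableEmbedding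
  have h := hmp.setIntegral_preimage_emb hemb g (pbox (a + c))
  have e : (fun x : Fin (d + 1) → ℝ => x + c) ⁻¹' pbox (a + c) = pbox a := by
    ext x
    simp only [Set.mem_preimage, pbox, Set.mem_univ_pi, Pi.add_apply, Set.mem_Ioc]
    refine forall_congr' fun i => ?_
    constructor
    · rintro ⟨h1, h2⟩; exact ⟨by linarith, by linarith⟩
    · rintro ⟨h1, h2⟩; exact ⟨by linarith, by linarith⟩
  rw [e] at h
  exact h

/-- [folklore] **TRANSLATION INVARIANCE OF THE ZONE INTEGRAL OF A PERIODIC FUNCTION**: for `F : ℝ^{d+1} → ℂ` with `F(p + 2πk) = F(p)`, `k ∈ ℤ^{d+1}`,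
`∫_{q ∈ [-π,π]^{d+1}} F(p + q) dq = ∫_{q ∈ [-π,π]^{d+1}} F(q) dq` for every real `p` (zone = centred period box a.e., translate the box, and leaf-17's
`AliasTiling.setIntegral_pbox_eq_BZ`: every period box integrates a periodic function like the zone — no integrability needed). -/
theorem setIntegral_BZ_comp_add_of_periodic (F : (Fin (d + 1) → ℝ) → ℂ)
    (hF : ∀ (r : Fin (d + 1) → ℝ) (k : Fin (d + 1) → ℤ), F (fun i => r i + 2 * π * k i) = F r) (p : Fin (d + 1) → ℝ) :
    ∫ q in BZ (d + 1), F (p + q) = ∫ q in BZ (d + 1), F q := by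
  have e : (fun q : Fin (d + 1) → ℝ => F (p + q)) = fun q => F (q + p) := by funext q; rw [add_comm]
  calc ∫ q in BZ (d + 1), F (p + q) = ∫ q in pbox (fun _ : Fin (d + 1) => -π), F (p + q) :=
        (setIntegral_congr_set pbox_neg_pi_ae_eq_BZ).symm
    _ = ∫ y in pbox ((fun _ : Fin (d + 1) => -π) + p), F y := by rw [e]; exact setIntegral_pbox_comp_add F _ p
    _ = ∫ y in BZ (d + 1), F y := setIntegral_pbox_eq_BZ F hF _

end Translation

/-! ## §3 The diagonal lemma -/

section Diagonal

variable {H : (Fin (d + 1) → ℂ) → ℂ} {κ M : ℝ}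

/-- [folklore] the two halves of a real joint point add to a real point. -/
theorem fstC_add_sndC_ofRealVec (R : Fin (d + 1 + d + 1) → ℝ) :
    fstC (ofRealVec R) + sndC (ofRealVec R) = ofRealVec (fun i => R (inl2 i) + R (inr2 i)) := by
  funext i
  simp only [Pi.add_apply, fstC_apply, sndC_apply, ofRealVec, Complex.ofReal_add]

/-- [folklore] raising an updated coordinate by `2π` on the left summand is an update of the sum. -/
theorem update_add_eq_update_sum_left (p q : Fin (d + 1) → ℂ) (i : Fin (d + 1)) (z : ℂ) :
    Function.update p i (z + 2 * π) + q = Function.update (Function.update p i z + q) i ((Function.update p i z + q) i + 2 * π) := by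
  funext j
  by_cases hj : j = i
  · subst hj; simp only [Pi.add_apply, Function.update_self]; ring
  · simp only [Pi.add_apply, Function.update_of_ne hj]

/-- [folklore] the same on the right summand. -/
theorem update_add_eq_update_sum_right (p q : Fin (d + 1) → ℂ) (i : Fin (d + 1)) (z : ℂ) :
    p + Function.update q i (z + 2 * π) = Function.update (p + Function.update q i z) i ((p + Function.update q i z) i + 2 * π) := by
  funext j
  by_cases hj : j = i
  · subst hj; simp only [Pi.add_apply, Function.update_self]; ring
  · simp only [Pi.add_apply, Function.update_of_ne hj]

/-- [folklore] `π + yI = (−π + yI) + 2π`. -/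
theorem pi_side_eq (y : ℝ) : ((Real.pi : ℂ) + y * I) = (-(Real.pi : ℂ) + y * I) + 2 * π := by ring

/-- [folklore] **THE SHEARED SYMBOL IS JOINTLY STRIP REGULAR OF HALF-WIDTH ZERO**: for a strip-regular, globally `2π`-periodic `H`, the two-momentum
symbol `(p, q) ↦ H(p + q)` is continuous on the real joint zone, side-matching in every joint coordinate, and bounded by `M` (holomorphy: vacuous). -/
theorem stripRegular_joint_shear (h : StripRegular H κ M) (hκ : 0 ≤ κ)
    (hper : ∀ (i : Fin (d + 1)) (p : Fin (d + 1) → ℂ), H (Function.update p i (p i + 2 * π)) = H p) :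
    StripRegular (joint fun p q => H (p + q)) 0 M := by
  refine stripRegular_of_update ?_ ?_ ?_ ?_
  · -- continuity on the real joint zone
    have hre : Continuous fun P : Fin (d + 1 + d + 1) → ℂ => reVec P :=
      continuous_pi fun μ => Complex.continuous_re.comp (continuous_apply μ)
    have hc : Continuous fun P : Fin (d + 1 + d + 1) → ℂ => H (ofRealVec fun i => reVec P (inl2 i) + reVec P (inr2 i)) := by
      refine (continuous_ofRealVec_of_periodic h hκ hper).comp ?_
      exact continuous_pi fun i => ((continuous_apply (inl2 i)).comp hre).add ((continuous_apply (inr2 i)).comp hre)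
    refine hc.continuousOn.congr fun P hP => ?_
    show joint (fun p q => H (p + q)) P = H (ofRealVec fun i => reVec P (inl2 i) + reVec P (inr2 i))
    rw [joint_apply, ← fstC_add_sndC_ofRealVec, ofRealVec_reVec_of_mem_Strip_zero hP]
  · intro l Q hQ
    rw [openRect_zero]
    exact differentiableOn_empty
  · intro l Q hQ y hy
    rcases inl2_or_inr2 l with ⟨i, rfl⟩ | ⟨i, rfl⟩
    · rw [joint_apply, joint_apply, fstC_update_inl2, sndC_update_inl2, fstC_update_inl2, sndC_update_inl2, pi_side_eq,
        update_add_eq_update_sum_left, hper]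
    · rw [joint_apply, joint_apply, fstC_update_inr2, sndC_update_inr2, fstC_update_inr2, sndC_update_inr2, pi_side_eq,
        update_add_eq_update_sum_right, hper]
  · intro P hP
    rw [joint_apply, ← ofRealVec_reVec_of_mem_Strip_zero hP, fstC_add_sndC_ofRealVec]
    exact norm_le_of_periodic h hκ hper _

/-- [folklore] additivity of the phase in the momentum. -/
theorem phase_add_left (p q : Fin (d + 1) → ℝ) (x : Fin (d + 1) → ℤ) : phase (p + q) x = phase p x + phase q x := by
  unfold B4ContourShift.phase
  rw [← Finset.sum_add_distrib]
  refine Finset.sum_congr rfl fun μ _ => ?_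
  simp only [Pi.add_apply, Complex.ofReal_add]
  ring

/-- [folklore] the phase is `2π`-periodic in the momentum up to an INTEGER multiple of `2π`: `φ(r + 2πk, b) = φ(r, b) + 2π (k·b)`. -/
theorem phase_add_intVec (r : Fin (d + 1) → ℝ) (k b : Fin (d + 1) → ℤ) :
    phase (fun i => r i + 2 * π * k i) b = phase r b + 2 * π * ((∑ i, k i * b i : ℤ) : ℂ) := by
  unfold B4ContourShift.phase
  rw [Int.cast_sum, Finset.mul_sum, ← Finset.sum_add_distrib]
  refine Finset.sum_congr rfl fun μ _ => ?_
  push_cast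
  ring

/-- [folklore] `ofRealVec` is additive. -/
theorem ofRealVec_add (p q : Fin (d + 1) → ℝ) : ofRealVec (p + q) = ofRealVec p + ofRealVec q := by
  funext μ; simp [ofRealVec]

/-- [folklore] **THE INNER KERNEL OF THE SHEARED SYMBOL** at a real first momentum `p`: `K[q ↦ H(p + q)](b) = e^{−ip·b} · K[H](b)` (translation
invariance of the zone integral of the periodic function `r ↦ H(r) e^{ir·b}`). -/
theorem latticeKernel_shear_inner (hper : ∀ (i : Fin (d + 1)) (p : Fin (d + 1) → ℂ), H (Function.update p i (p i + 2 * π)) = H p)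
    (p : Fin (d + 1) → ℝ) (b : Fin (d + 1) → ℤ) :
    latticeKernel (fun q => H (ofRealVec p + q)) b = cexp (-(I * phase p b)) * latticeKernel H b := by
  -- the periodic function
  set F : (Fin (d + 1) → ℝ) → ℂ := fun r => H (ofRealVec r) * cexp (I * phase r b) with hFdef
  have hF : ∀ (r : Fin (d + 1) → ℝ) (k : Fin (d + 1) → ℤ), F (fun i => r i + 2 * π * k i) = F r := by
    intro r k
    simp only [hFdef]
    have e1 : ofRealVec (fun i => r i + 2 * π * (k i : ℝ)) = ofRealVec r + fun i => (2 * π * (k i : ℝ) : ℂ) := by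
      funext i; simp only [ofRealVec, Pi.add_apply]; push_cast; ring
    rw [e1, periodic_add_intVec hper, phase_add_intVec, mul_add, Complex.exp_add]
    have e2 : cexp (I * (2 * π * ((∑ i, k i * b i : ℤ) : ℂ))) = 1 := by
      rw [show I * (2 * π * ((∑ i, k i * b i : ℤ) : ℂ)) = ((∑ i, k i * b i : ℤ) : ℂ) * (2 * π * I) by ring]
      exact Complex.exp_int_mul_two_pi_mul_I _
    rw [e2, mul_one]
  have e : ∀ q : Fin (d + 1) → ℝ, integrand (fun q => H (ofRealVec p + q)) b q = cexp (-(I * phase p b)) * F (p + q) := by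
    intro q
    unfold integrand
    simp only [hFdef]
    rw [← ofRealVec_add, phase_add_left, mul_add, Complex.exp_add]
    have h1 : cexp (-(I * phase p b)) * cexp (I * phase p b) = 1 := by rw [← Complex.exp_add]; simp
    rw [show cexp (-(I * phase p b)) * (H (ofRealVec (p + q)) * (cexp (I * phase p b) * cexp (I * phase q b))) =
        H (ofRealVec (p + q)) * cexp (I * phase q b) * (cexp (-(I * phase p b)) * cexp (I * phase p b)) by ring, h1, mul_one]
  unfold latticeKernel B4ContourShift.fourierBox
  rw [setIntegral_congr_fun (by unfold BZ; exact measurableSet_Icc) (fun q _ => e q), integral_const_mul,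
    setIntegral_BZ_comp_add_of_periodic F hF p, mul_smul_comm]
  rfl

/-- [folklore] **THE DIAGONAL LEMMA**: for a strip-regular (`κ ≥ 0`), globally `2π`-periodic symbol `H`, the two-momentum kernel of the sheared symbol
`(p, q) ↦ H(p + q)` is DIAGONAL with the one-momentum kernel on the diagonal:
`latticeKernel₂ (fun p q => H (p + q)) a b = if a = b then latticeKernel H a else 0` (momentum conservation at a vertex). -/
theorem latticeKernel₂_shear (h : StripRegular H κ M) (hκ : 0 ≤ κ)
    (hper : ∀ (i : Fin (d + 1)) (p : Fin (d + 1) → ℂ), H (Function.update p i (p i + 2 * π)) = H p) (a b : Fin (d + 1) → ℤ) :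
    latticeKernel₂ (fun p q => H (p + q)) a b = if a = b then latticeKernel H a else 0 := by
  rw [latticeKernel₂_eq_iterated (stripRegular_joint_shear h hκ hper) le_rfl a b]
  rw [latticeKernel_congr (G1 := fun p => latticeKernel (fun q => H (p + q)) b)
      (G2 := fun P => cexp (I * phaseC P (-b)) * latticeKernel H b) (fun s _ => ?_) a]
  · rw [latticeKernel_phase_mul (fun _ => latticeKernel H b) a (-b), latticeKernel_const]
    by_cases hab : a = b
    · subst hab; simp
    · rw [if_neg hab, if_neg]
      intro h0
      exact hab (eq_of_sub_eq_zero (by rwa [sub_eq_add_neg]))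
  · show latticeKernel (fun q => H (ofRealVec s + q)) b = cexp (I * phaseC (ofRealVec s) (-b)) * latticeKernel H b
    -- `phase s (−b) = −phase s b` (the tree's `DirichletExhaustionDeltaZSymm.phase_neg`, re-derived in two lines to keep this engine's imports light)
    have hneg : phase s (-b) = -phase s b := by
      simp only [B4ContourShift.phase, Pi.neg_apply, Int.cast_neg, mul_neg, Finset.sum_neg_distrib]
    rw [latticeKernel_shear_inner hper s b, B4Green244.phaseC_ofRealVec, hneg, mul_neg]

end Diagonal

end Summit.QuantumFields.BalabanUV.Beta.GAN24.LatticeKernelDiagonal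

end
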